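import Summits.Parity.GeneralizedHardyLittlewood.Theorems.RangeQualityExchangeCoreLower

/-!
# Range–quality exchange (3/5): the exchange rate

Part of the decomp-parity lens-5 g10 certificate «RangeQualityExchange» (NODE HOME/STATUS.md l.484, critic CLEARED l.490 =
CRITIC-LEDGER row 89, writer DECISION L7 l.491: zero credit, helper beneath the existing leaf UU 26853), landed from the lens hand
`HOME/decomp-parity-lens-5/g10/hand/RangeQualityExchange.lean` (sha16 fc7ece3ca225b2c0, 1301 lines, rc 0 · 0 sorry · standard axioms)
VERBATIM by section in five files for the 400-line Theorems lint by the cell's prover-class seat census-1 g10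
(`RangeQualityExchangeCore` → `RangeQualityExchangeCoreLower` → `RangeQualityExchangeRate` → `RangeQualityExchangeNecessity` →
`RangeQualityExchange`; vocabulary `Theorems/RangeQualityExchangeDefs.lean`, p772649).  The hand's `private` shift-pair dictionary
copies (of `Theorems/PairsToGHL/Negative/{ShiftPairDictionary,UnboundedSiegelZeros}.lean`, which do not build on the current farm
snapshot, remote:stale:unbuilt 2026-08-30) stay `private` and sit in the part(s) that use them.

This file: `tendsto_log_pow_six_div(_rpow)`, `rangeReachingZeros_pow_of_unboundedSiegelZeros` (polynomial ranges are reached by zeros of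
merely unbounded quality), `scale_window`, `rangeReachingZeros_stretched_of_qualityAbove` and the converse
`qualityAbove_of_rangeReachingZeros_stretched` (rate κ ⟷ A = 1/κ − 1, exact), `not_qualityAbove_of_zeroFreeRegion`,
`not_rangeReachingZeros_stretched_of_zeroFreeRegion`, `not_rangeReachingZeros_polylog` (Siegel-inert base range: tree `exists_siegelZero_quality_le`).
-/

open Finset Filter MeasureTheory
open scoped Topology ArithmeticFunction.vonMangoldt
open Literature.NumberTheory.Sieve Literature.Barriers.Parity
open Summit.Parity.GeneralizedHardyLittlewood.Theses

noncomputable section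

namespace Summit.Parity.GeneralizedHardyLittlewood.RangeQualityExchange

/-! ## The exchange rate -/

/-- `log⁶ η / η → 0`. [folklore] -/
theorem tendsto_log_pow_six_div : Tendsto (fun η : ℝ => Real.log η ^ 6 / η) atTop (𝓝 0) := by
  have := Real.tendsto_pow_log_div_mul_add_atTop 1 0 6 one_ne_zero
  refine this.congr' (Eventually.of_forall fun η => ?_)
  simp only [one_mul, add_zero]

/-- `log⁶ η / η^s → 0` for `s > 0`. [folklore] -/
theorem tendsto_log_pow_six_div_rpow {s : ℝ} (hs : 0 < s) :
    Tendsto (fun η : ℝ => Real.log η ^ 6 / η ^ s) atTop (𝓝 0) := by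
  have h := (isLittleO_log_rpow_rpow_atTop (6 : ℝ) hs).tendsto_div_nhds_zero
  refine h.congr' (Eventually.of_forall fun η => ?_)
  simp only []
  rw [show (6 : ℝ) = ((6 : ℕ) : ℝ) by norm_num, Real.rpow_natCast]

/-- **POLYNOMIAL ranges are reached by zeros of merely unbounded quality** (`V` constant:
`V = max 10 ⌈2/θ⌉`, `N^θ = q^{Vθ} ≥ q² ≥ 2q`). [cite: MatomakiMerikoski2023, Theorem 1.3] -/
theorem rangeReachingZeros_pow_of_unboundedSiegelZeros {θ : ℝ} (hθ : 0 < θ)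
    (hU : UnboundedSiegelZeros) : RangeReachingZeros (fun N => (N : ℝ) ^ θ) := by
  intro δ hδ η₀ q₀
  set V : ℕ := max 10 ⌈2 / θ⌉₊ with hVdef
  have hV10 : 10 ≤ V := le_max_left _ _
  have hVθ : 2 ≤ (V : ℝ) * θ := by
    have h1 : 2 / θ ≤ (V : ℝ) := (Nat.le_ceil (2 / θ)).trans (by exact_mod_cast le_max_right 10 ⌈2 / θ⌉₊)
    exact (div_le_iff₀ hθ).mp h1
  -- `V log⁶η/η ≤ δ` eventually (V is fixed)
  have hT : ∀ᶠ η : ℝ in atTop, (V : ℝ) * Real.log η ^ 6 / η ≤ δ := by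
    have h1 : Tendsto (fun η : ℝ => (V : ℝ) * Real.log η ^ 6 / η) atTop (𝓝 0) := by
      have := tendsto_log_pow_six_div.const_mul (V : ℝ)
      rw [mul_zero] at this
      refine this.congr' (Eventually.of_forall fun η => ?_)
      simp only []
      ring
    exact (h1.eventually (gt_mem_nhds hδ)).mono fun _ h => h.le
  obtain ⟨η₂, hη₂⟩ := eventually_atTop.mp hT
  obtain ⟨q, inst, χ, η, hq, hη, hz⟩ := hU (max η₀ η₂) (max q₀ 2)
  have hq2 : 2 ≤ q := le_of_max_le_right hq
  refine ⟨q, inst, χ, η, V, le_of_max_le_left hq, le_of_max_le_left hη, hz, hV10,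
    hη₂ η (le_of_max_le_right hη), ?_⟩
  -- `2q ≤ q² ≤ q^{Vθ} = (q^V)^θ`
  have hq1 : (1 : ℝ) ≤ q := by exact_mod_cast (show 1 ≤ q by omega)
  have hq0 : (0 : ℝ) ≤ q := by linarith
  have h2q : ((2 * q : ℕ) : ℝ) ≤ (q : ℝ) ^ ((2 : ℕ) : ℝ) := by
    rw [Real.rpow_natCast]; exact_mod_cast (show 2 * q ≤ q ^ 2 by nlinarith)
  show ((2 * q : ℕ) : ℝ) ≤ ((q ^ V : ℕ) : ℝ) ^ θ
  calc ((2 * q : ℕ) : ℝ) ≤ (q : ℝ) ^ ((2 : ℕ) : ℝ) := h2q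
    _ ≤ (q : ℝ) ^ ((V : ℝ) * θ) := Real.rpow_le_rpow_of_exponent_le hq1 (by norm_num; exact hVθ)
    _ = ((q ^ V : ℕ) : ℝ) ^ θ := by rw [Real.rpow_mul hq0, Real.rpow_natCast, Nat.cast_pow]

/-- **The exchange rate.** For `0 < κ ≤ 1`, `B > 1/κ - 1`, `δ > 0`: every large enough quality
`η ≥ (log q)^B` (`q ≥ 2`) admits an INTEGER scale exponent `V ≥ 10` inside the Matomäki–Merikoski
window `V log⁶η/η ≤ δ` whose scale `N = q^V` brings the excess shift `2q` within the stretched range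
`exp((log N)^κ)`: with `V = ⌊δη/log⁶η⌋ ≥ 2^{1/κ} η^{(1/κ-1)/B}` one has
`(V log q)^κ ≥ 2 η^{(1-κ)/B} (log q)^κ ≥ 2 (log q)^{1-κ} (log q)^κ = 2 log q ≥ log 2q`.
[cite: MatomakiMerikoski2023, Theorem 1.3] -/
theorem scale_window {κ B δ : ℝ} (hκ0 : 0 < κ) (hκ1 : κ ≤ 1) (hB : 1 / κ - 1 < B) (hδ : 0 < δ) :
    ∃ η₂ : ℝ, ∀ η : ℝ, η₂ ≤ η → ∀ q : ℕ, 2 ≤ q → Real.log q ^ B ≤ η →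
      ∃ V : ℕ, 10 ≤ V ∧ (V : ℝ) * Real.log η ^ 6 / η ≤ δ ∧
        ((2 * q : ℕ) : ℝ) ≤ Real.exp (Real.log ((q ^ V : ℕ) : ℝ) ^ κ) := by
  have hκinv : 1 ≤ 1 / κ := by rw [le_div_iff₀ hκ0]; linarith
  have hBpos : 0 < B := by linarith
  -- exponents
  set e : ℝ := (1 - κ) / B with he
  set γ : ℝ := e / κ with hγ
  have he0 : 0 ≤ e := div_nonneg (by linarith) hBpos.le
  have hγ0 : 0 ≤ γ := div_nonneg he0 hκ0.le
  have hγ1 : γ < 1 := by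
    rw [hγ, div_lt_one hκ0, he, div_lt_iff₀ hBpos]
    have : 1 / κ - 1 = (1 - κ) / κ := by field_simp
    nlinarith [mul_lt_mul_of_pos_right hB hκ0, this, mul_div_cancel₀ (1 - κ) hκ0.ne']
  set s : ℝ := 1 - γ with hsdef
  have hs : 0 < s := by linarith
  set c₀ : ℝ := (2 : ℝ) ^ κ⁻¹ with hc₀
  have hc₀pos : 0 < c₀ := Real.rpow_pos_of_pos two_pos _
  -- thresholds in `η`
  have hA : ∀ᶠ η : ℝ in atTop, Real.log η ^ 6 / η < δ / 11 :=
    tendsto_log_pow_six_div.eventually (gt_mem_nhds (by positivity))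
  have hC : ∀ᶠ η : ℝ in atTop, Real.log η ^ 6 / η ^ s < δ / (2 * c₀) :=
    (tendsto_log_pow_six_div_rpow hs).eventually (gt_mem_nhds (by positivity))
  obtain ⟨η₂, hη₂⟩ := eventually_atTop.mp (hA.and (hC.and (eventually_ge_atTop 10)))
  refine ⟨η₂, fun η hη q hq hqual => ?_⟩
  obtain ⟨hAη, hCη, hη10⟩ := hη₂ η hη
  have hηpos : 0 < η := by linarith
  have hlogη : 0 < Real.log η := Real.log_pos (by linarith)
  have hl6 : 0 < Real.log η ^ 6 := pow_pos hlogη 6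
  have hηs : 0 < η ^ s := Real.rpow_pos_of_pos hηpos s
  have hηγ : 0 ≤ η ^ γ := Real.rpow_nonneg hηpos.le γ
  -- the scale exponent
  set M : ℝ := δ * η / Real.log η ^ 6 with hM
  have hM11 : 11 < M := by
    rw [hM, lt_div_iff₀ hl6]
    have := (div_lt_iff₀ hηpos).mp hAη
    linarith
  have hM0 : 0 ≤ M := by linarith
  set V : ℕ := ⌊M⌋₊ with hV
  have hV10 : 10 ≤ V := (Nat.le_floor_iff hM0).mpr (by norm_num; linarith)
  have hVM : (V : ℝ) ≤ M := Nat.floor_le hM0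
  have hVlow : M - 1 < V := by have := Nat.lt_floor_add_one M; linarith
  refine ⟨V, hV10, ?_, ?_⟩
  · -- inside the window: `V log⁶η ≤ δη`
    rw [div_le_iff₀ hηpos]
    exact (le_div_iff₀ hl6).mp hVM
  · -- reach: `c₀ η^γ ≤ M/2 ≤ V`
    have hVc : c₀ * η ^ γ ≤ V := by
      have h1 : 2 * c₀ * Real.log η ^ 6 < δ * η ^ s := by
        have := (div_lt_iff₀ hηs).mp hCη
        have h2c : 0 < 2 * c₀ := by positivity
        calc 2 * c₀ * Real.log η ^ 6 < 2 * c₀ * (δ / (2 * c₀) * η ^ s) :=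
              mul_lt_mul_of_pos_left this h2c
          _ = δ * η ^ s := by field_simp
      have hηsplit : η ^ γ * η ^ s = η := by
        rw [← Real.rpow_add hηpos, hsdef, add_sub_cancel, Real.rpow_one]
      have h2 : c₀ * η ^ γ * (2 * Real.log η ^ 6) ≤ δ * η := by
        calc c₀ * η ^ γ * (2 * Real.log η ^ 6) = η ^ γ * (2 * c₀ * Real.log η ^ 6) := by ring
          _ ≤ η ^ γ * (δ * η ^ s) := mul_le_mul_of_nonneg_left h1.le hηγ
          _ = δ * (η ^ γ * η ^ s) := by ring
          _ = δ * η := by rw [hηsplit]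
      have h3 : c₀ * η ^ γ ≤ M / 2 := by
        rw [hM, div_div, mul_comm (Real.log η ^ 6) 2]
        exact (le_div_iff₀ (by positivity)).mpr h2
      linarith
    -- logarithms
    have hq2r : (2 : ℝ) ≤ q := by exact_mod_cast hq
    have hqpos : (0 : ℝ) < q := by linarith
    have hlogq : 0 < Real.log q := Real.log_pos (by linarith)
    have hlog2q : Real.log ((2 * q : ℕ) : ℝ) ≤ 2 * Real.log q := by
      rw [Nat.cast_mul, Nat.cast_ofNat, Real.log_mul two_ne_zero hqpos.ne']
      linarith [Real.log_le_log two_pos hq2r]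
    have hc₀κ : c₀ ^ κ = 2 := by rw [hc₀]; exact Real.rpow_inv_rpow (by norm_num) hκ0.ne'
    have hγκ : γ * κ = e := by rw [hγ]; field_simp
    have hBe : B * e = 1 - κ := by rw [he]; field_simp
    have hηe : Real.log q ^ (1 - κ) ≤ η ^ e := by
      calc Real.log q ^ (1 - κ) = (Real.log q ^ B) ^ e := by rw [← Real.rpow_mul hlogq.le, hBe]
        _ ≤ η ^ e := Real.rpow_le_rpow (Real.rpow_nonneg hlogq.le B) hqual he0
    have hmain : 2 * Real.log q ≤ ((V : ℝ) * Real.log q) ^ κ := by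
      have hbase : 0 ≤ c₀ * η ^ γ * Real.log q := by positivity
      calc 2 * Real.log q = 2 * (Real.log q ^ (1 - κ) * Real.log q ^ κ) := by
              rw [← Real.rpow_add hlogq, sub_add_cancel, Real.rpow_one]
        _ ≤ 2 * (η ^ e * Real.log q ^ κ) := by
              have := mul_le_mul_of_nonneg_right hηe (Real.rpow_nonneg hlogq.le κ)
              linarith
        _ = (c₀ * η ^ γ * Real.log q) ^ κ := by
              rw [Real.mul_rpow (by positivity) hlogq.le, Real.mul_rpow hc₀pos.le hηγ, hc₀κ,
                ← Real.rpow_mul hηpos.le, hγκ]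
              ring
        _ ≤ ((V : ℝ) * Real.log q) ^ κ :=
              Real.rpow_le_rpow hbase (mul_le_mul_of_nonneg_right hVc hlogq.le) hκ0.le
    have h2qpos : (0 : ℝ) < ((2 * q : ℕ) : ℝ) := by positivity
    calc ((2 * q : ℕ) : ℝ) = Real.exp (Real.log ((2 * q : ℕ) : ℝ)) := (Real.exp_log h2qpos).symm
      _ ≤ Real.exp (Real.log ((q ^ V : ℕ) : ℝ) ^ κ) := by
          rw [Real.exp_le_exp, Nat.cast_pow, Real.log_pow]
          linarith

/-- **STRETCHED ranges `exp((log N)^κ)` are reached by zeros of quality `(log q)^B`, `B > 1/κ - 1`.**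
[cite: MatomakiMerikoski2023, Theorem 1.3] -/
theorem rangeReachingZeros_stretched_of_qualityAbove {κ B : ℝ} (hκ0 : 0 < κ) (hκ1 : κ ≤ 1)
    (hB : 1 / κ - 1 < B) (hQ : QualityAbove B) :
    RangeReachingZeros (fun N => Real.exp (Real.log N ^ κ)) := by
  have hκinv : 1 ≤ 1 / κ := by rw [le_div_iff₀ hκ0]; linarith
  have hBpos : 0 < B := by linarith
  intro δ hδ η₀ q₀
  obtain ⟨η₂, hη₂⟩ := scale_window hκ0 hκ1 hB hδ
  obtain ⟨q₁, hq₁⟩ := eventually_atTop.mp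
    (((tendsto_log_natCast_rpow hBpos).eventually_ge_atTop (max η₀ η₂)).and (eventually_ge_atTop 2))
  obtain ⟨q, inst, χ, η, hq, hqual, hz⟩ := hQ (max q₀ q₁)
  obtain ⟨hbig, hq2⟩ := hq₁ q (le_of_max_le_right hq)
  have hη : max η₀ η₂ ≤ η := hbig.trans hqual
  obtain ⟨V, hV10, hVη, hreach⟩ := hη₂ η (le_of_max_le_right hη) q hq2 hqual
  exact ⟨q, inst, χ, η, V, le_of_max_le_left hq, le_of_max_le_left hη, hz, hV10, hVη, hreach⟩

/-- **Converse of the exchange rate (the rate is exact).** A zero reaching the stretched range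
`exp((log N)^κ)` has quality `η ≥ (log q)^{1/κ - 1}`: `log 2q ≤ (V log q)^κ ≤ (η log q)^κ` since
`V ≤ δη/log⁶η ≤ η`. [cite: MatomakiMerikoski2023, Theorem 1.3] -/
theorem qualityAbove_of_rangeReachingZeros_stretched {κ : ℝ} (hκ0 : 0 < κ)
    (h : RangeReachingZeros (fun N => Real.exp (Real.log N ^ κ))) : QualityAbove (1 / κ - 1) := by
  intro q₀
  obtain ⟨q, inst, χ, η, V, hq, -, hz, hV10, hVη, hreach⟩ := h 1 one_pos 10 (max q₀ 2)
  refine ⟨q, inst, χ, η, le_of_max_le_left hq, ?_, hz⟩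
  have hq2 : 2 ≤ q := le_of_max_le_right hq
  have hη10 : 10 ≤ η := hz.ten_le
  have hηpos : 0 < η := by linarith
  have hq2r : (2 : ℝ) ≤ q := by exact_mod_cast hq2
  have hqpos : (0 : ℝ) < q := by linarith
  have hlogq : 0 < Real.log q := Real.log_pos (by linarith)
  have hlogη : 1 ≤ Real.log η := by
    rw [Real.le_log_iff_exp_le hηpos]
    have := Real.exp_one_lt_d9; norm_num at this; linarith
  have hVη' : (V : ℝ) ≤ η := by
    have h1 : (V : ℝ) * Real.log η ^ 6 ≤ 1 * η := (div_le_iff₀ hηpos).mp hVη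
    have h6 : 1 ≤ Real.log η ^ 6 := one_le_pow₀ hlogη
    nlinarith [Nat.cast_nonneg (α := ℝ) V]
  have h2qpos : (0 : ℝ) < ((2 * q : ℕ) : ℝ) := by positivity
  have hreach' : Real.log ((2 * q : ℕ) : ℝ) ≤ ((V : ℝ) * Real.log q) ^ κ := by
    have := hreach
    simp only [Nat.cast_pow, Real.log_pow] at this
    exact (Real.log_le_iff_le_exp h2qpos).mpr this
  have hlogq_le : Real.log q ≤ Real.log ((2 * q : ℕ) : ℝ) :=
    Real.log_le_log hqpos (by exact_mod_cast (show q ≤ 2 * q by omega))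
  have h1 : Real.log q ≤ (η * Real.log q) ^ κ :=
    hlogq_le.trans (hreach'.trans
      (Real.rpow_le_rpow (by positivity) (mul_le_mul_of_nonneg_right hVη' hlogq.le) hκ0.le))
  have h2 : Real.log q ^ (1 / κ) ≤ η * Real.log q := by
    have := Real.rpow_le_rpow hlogq.le h1 (by positivity : (0 : ℝ) ≤ 1 / κ)
    rwa [← Real.rpow_mul (by positivity), mul_one_div_cancel hκ0.ne', Real.rpow_one] at this
  calc Real.log q ^ (1 / κ - 1) = Real.log q ^ (1 / κ) / Real.log q := Real.rpow_sub_one hlogq.ne' _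
    _ ≤ η := by rw [div_le_iff₀ hlogq]; exact h2

/-- Every range-reaching family is in particular a family of unbounded quality. [folklore] -/
theorem unboundedSiegelZeros_of_rangeReachingZeros {R : ℕ → ℝ} (h : RangeReachingZeros R) :
    UnboundedSiegelZeros := by
  intro η₀ q₀
  obtain ⟨q, inst, χ, η, V, hq, hη, hz, -, -, -⟩ := h 1 one_pos η₀ q₀
  exact ⟨q, inst, χ, η, hq, hη, hz⟩

/-- The same exchange rate on the lower-side family `4 ∣ q` (the deficit shift `q/2 ≤ 2q` is reached a
fortiori). [cite: MatomakiMerikoski2023, Theorem 1.3] -/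
theorem rangeReachingZerosFour_stretched_of_qualityAboveFour {κ B : ℝ} (hκ0 : 0 < κ) (hκ1 : κ ≤ 1)
    (hB : 1 / κ - 1 < B) (hQ : QualityAboveFour B) :
    RangeReachingZerosFour (fun N => Real.exp (Real.log N ^ κ)) := by
  have hκinv : 1 ≤ 1 / κ := by rw [le_div_iff₀ hκ0]; linarith
  have hBpos : 0 < B := by linarith
  intro δ hδ η₀ q₀
  obtain ⟨η₂, hη₂⟩ := scale_window hκ0 hκ1 hB hδ
  obtain ⟨q₁, hq₁⟩ := eventually_atTop.mp
    (((tendsto_log_natCast_rpow hBpos).eventually_ge_atTop (max η₀ η₂)).and (eventually_ge_atTop 2))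
  obtain ⟨q, inst, χ, η, hq, h4, hqual, hz⟩ := hQ (max q₀ q₁)
  obtain ⟨hbig, hq2⟩ := hq₁ q (le_of_max_le_right hq)
  have hη : max η₀ η₂ ≤ η := hbig.trans hqual
  obtain ⟨V, hV10, hVη, hreach⟩ := hη₂ η (le_of_max_le_right hη) q hq2 hqual
  have hhalf : ((q / 2 : ℕ) : ℝ) ≤ ((2 * q : ℕ) : ℝ) := by
    exact_mod_cast (show q / 2 ≤ 2 * q by omega)
  exact ⟨q, inst, χ, η, V, le_of_max_le_left hq, le_of_max_le_left hη, h4, hz, hV10, hVη,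
    hhalf.trans hreach⟩


/-- Polynomial ranges, lower-side family. [cite: MatomakiMerikoski2023, Theorem 1.3] -/
theorem rangeReachingZerosFour_pow_of_unboundedSiegelZerosFour {θ : ℝ} (hθ : 0 < θ)
    (hU : UnboundedSiegelZerosFour) : RangeReachingZerosFour (fun N => (N : ℝ) ^ θ) := by
  intro δ hδ η₀ q₀
  set V : ℕ := max 10 ⌈2 / θ⌉₊ with hVdef
  have hV10 : 10 ≤ V := le_max_left _ _
  have hVθ : 2 ≤ (V : ℝ) * θ := by
    have h1 : 2 / θ ≤ (V : ℝ) := (Nat.le_ceil (2 / θ)).trans (by exact_mod_cast le_max_right 10 ⌈2 / θ⌉₊)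
    exact (div_le_iff₀ hθ).mp h1
  have hT : ∀ᶠ η : ℝ in atTop, (V : ℝ) * Real.log η ^ 6 / η ≤ δ := by
    have h1 : Tendsto (fun η : ℝ => (V : ℝ) * Real.log η ^ 6 / η) atTop (𝓝 0) := by
      have := tendsto_log_pow_six_div.const_mul (V : ℝ)
      rw [mul_zero] at this
      refine this.congr' (Eventually.of_forall fun η => ?_)
      simp only []
      ring
    exact (h1.eventually (gt_mem_nhds hδ)).mono fun _ h => h.le
  obtain ⟨η₂, hη₂⟩ := eventually_atTop.mp hT
  obtain ⟨q, inst, χ, η, hq, hη, h4, hz⟩ := hU (max η₀ η₂) (max q₀ 2)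
  have hq2 : 2 ≤ q := le_of_max_le_right hq
  refine ⟨q, inst, χ, η, V, le_of_max_le_left hq, le_of_max_le_left hη, h4, hz, hV10,
    hη₂ η (le_of_max_le_right hη), ?_⟩
  have hq1 : (1 : ℝ) ≤ q := by exact_mod_cast (show 1 ≤ q by omega)
  have hq0 : (0 : ℝ) ≤ q := by linarith
  have h2q : ((q / 2 : ℕ) : ℝ) ≤ (q : ℝ) ^ ((2 : ℕ) : ℝ) := by
    rw [Real.rpow_natCast]
    exact_mod_cast (show q / 2 ≤ q ^ 2 by nlinarith [Nat.div_le_self q 2])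
  show ((q / 2 : ℕ) : ℝ) ≤ ((q ^ V : ℕ) : ℝ) ^ θ
  calc ((q / 2 : ℕ) : ℝ) ≤ (q : ℝ) ^ ((2 : ℕ) : ℝ) := h2q
    _ ≤ (q : ℝ) ^ ((V : ℝ) * θ) := Real.rpow_le_rpow_of_exponent_le hq1 (by norm_num; exact hVθ)
    _ = ((q ^ V : ℕ) : ℝ) ^ θ := by rw [Real.rpow_mul hq0, Real.rpow_natCast, Nat.cast_pow]

end Summit.Parity.GeneralizedHardyLittlewood.RangeQualityExchange
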